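import Literature.Dynamics.NBody.JensenLeykin2025
import Literature.Dynamics.NBody.JensenLeykin2025S3Dictionary

/-!
# Typed TARGET of the valued cell-kill certificate on the line `(2, 2, 3, 3, ·) ⊂ E₃₂`
(venture `CentralConfigurations`, cell `pub-smale6`, seat 2 tropical route)

HONEST FRAMING (cell brief): closing part of a known exceptional set by certified computer algebra; not a new method.

The certificate `HOME/certs/tropical_e32/vcell_S3_001/CERT.md` (valued tropical prevariety of the enriched system S3
at masses `(2, 2, 3, 3, 5t)` over `ℂ{{t}}`: Gröbner / resultant torus-infeasibility kills of valued initial systems,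
then pointedness of every surviving face-graph component; completed as a DERIVED certificate, cell REFEREE.md
R99–R100, two implementations, two hand reductions CERT §5/§5b, nothing kernel-checked) is what decides
`S3FiniteOnLine2233` below OUTSIDE the kernel.  The kernel part is only the transfer to positive normalized
central configurations (Albouy–Kaloshin's notion), `positiveNormalizedCCs_finite_of_s3Finite` from the tree
dictionary `Literature/Dynamics/NBody/JensenLeykin2025S3Dictionary.lean`.

Honest scope: finiteness on ONE explicit line of the Albouy–Kaloshin exceptional family `E₃₂ = {(a,a,b,b,c)}`
minus finitely many (non-explicit) points — NOT generic finiteness on `E₃₂` (`E32S3Target`), and nothing at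
the Roberts-type lines where S3 is infinite (`Literature.Dynamics.NBody.s3NormalizedCCs_44441_infinite`).

Provenance: port of the cell's staged `HOME/lean/Smale6N5S3Line2233.lean` (rc 0, referee gen 96), namespace
`Smale6N5` ↦ `Summit.Ventures.CentralConfigurations`; statements unchanged.
-/

namespace Summit.Ventures.CentralConfigurations

open Literature.Dynamics.NBody

/-- TARGET (seat 2, valued cell-kill certificate): there is a nonzero univariate polynomial `D ∈ ℚ[c]`
such that over every field of characteristic `0`, the enriched torus system S3 with masses
`(2, 2, 3, 3, c)` is finite whenever `D(c) ≠ 0`.  Decided by computation (CERT.md), not in-kernel. -/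
def S3FiniteOnLine2233 : Prop :=
  ∃ D : Polynomial ℚ, D ≠ 0 ∧
    ∀ (K : Type) [Field K] [CharZero K] (c : K),
      Polynomial.aeval c D ≠ 0 → (s3NormalizedCCs K ![(2 : K), 2, 3, 3, c]).Finite

/-- KERNEL GLUE: the target decides Albouy–Kaloshin finiteness on the real line `(2,2,3,3,c)`,
`c > -10` (positive total mass), away from the finitely many roots of `D`. -/
theorem positiveCC_finite_onLine2233_of_S3 (h : S3FiniteOnLine2233) :
    ∃ D : Polynomial ℚ, D ≠ 0 ∧ ∀ c : ℝ, 0 < 10 + c → Polynomial.aeval c D ≠ 0 →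
      (positiveNormalizedCCs (![(2 : ℝ), 2, 3, 3, c] : Fin 5 → ℝ)).Finite := by
  obtain ⟨D, hD0, hD⟩ := h
  refine ⟨D, hD0, fun c hM hDc => ?_⟩
  have hM' : 0 < ∑ k, (![(2 : ℝ), 2, 3, 3, c] : Fin 5 → ℝ) k := by
    simp [Fin.sum_univ_five]; linarith
  exact positiveNormalizedCCs_finite_of_s3Finite _ hM' (hD ℝ c hDc)

/-- In particular only finitely many real fifth masses `c > -10` can carry infinitely many positive
normalized central configurations with masses `(2,2,3,3,c)`. -/
theorem positiveCC_infinite_onLine2233_finite (h : S3FiniteOnLine2233) :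
    {c : ℝ | 0 < 10 + c ∧ ¬ (positiveNormalizedCCs (![(2 : ℝ), 2, 3, 3, c] : Fin 5 → ℝ)).Finite}.Finite := by
  obtain ⟨D, hD0, hD⟩ := positiveCC_finite_onLine2233_of_S3 h
  have hroots : {c : ℝ | Polynomial.aeval c D = 0}.Finite := by
    have hD' : (D.map (algebraMap ℚ ℝ)) ≠ 0 := by
      rwa [Ne, Polynomial.map_eq_zero]
    refine ((D.map (algebraMap ℚ ℝ)).roots.toFinset.finite_toSet).subset ?_
    intro c hc
    simp only [Set.mem_setOf_eq] at hc
    simp only [Finset.mem_coe, Multiset.mem_toFinset, Polynomial.mem_roots hD', Polynomial.IsRoot,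
      Polynomial.eval_map, ← Polynomial.aeval_def, hc]
  refine hroots.subset ?_
  intro c ⟨hM, hinf⟩
  by_contra hc
  exact hinf (hD c hM hc)

end Summit.Ventures.CentralConfigurations
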